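import Mathlib
import Literature.Computability.AlgebraicComplexity.StandardFamilies

/-!
# Coefficient degree bound for line `Sketch` of crux `CertWindowQP` (stmt-ValiantsHypothesis-5640)

Stub `stub_coeffDegree` of the registered skeleton. The polynomial system `Rep(n,m)` says
`per_n(x) = det(A₀ + ∑ₑ xₑ Aₑ)` identically in `x`; its unknowns are the entries of `A₀`
(variables `(none,(i,j))`) and of the `Aₑ` (variables `(some e,(i,j))`), and its axioms are the
`x`-coefficients of the defect `P = det(A₀ + ∑ₑ xₑ Aₑ) - per_n(x)`, an `x`-polynomial whose
coefficients are polynomials in the unknowns. We prove that every axiom has total degree `≤ m`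
in the unknowns (the input to the Skoda–Brownawell degree bound in `CertWindowQP_of`).

Proof: for `p : MvPolynomial σ (MvPolynomial τ R)` consider the property
"every `σ`-coefficient of `p` has total degree `≤ d`". It is preserved by sums, a product of a
degree-`≤ d` and a degree-`≤ e` polynomial has degree `≤ d + e` (`MvPolynomial.coeff_mul`), the
matrix entries `C (X v) + ∑ₑ X e * C (X wₑ)` have degree `≤ 1`, so by the Leibniz formula
(`Matrix.det_apply'`) the determinant has degree `≤ m`; the permanent contributes constants.
Mathlib only (plus the definition `perPoly`, used only through `MvPolynomial.coeff_map`).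
-/

open MvPolynomial

namespace Summit.ValiantsHypothesis.ValiantsHypothesis.Theorems

open Literature.Computability.AlgebraicComplexity

section CoeffDegree

variable {σ τ R : Type*} [CommRing R]

/-- The coefficients of `0` have total degree `≤ d`. -/
private theorem certWindowQP_cbdd_zero (d : ℕ) :
    ∀ μ, ((0 : MvPolynomial σ (MvPolynomial τ R)).coeff μ).totalDegree ≤ d :=
  fun μ => by simp

/-- Coefficientwise degree bounds are preserved by addition. -/
private theorem certWindowQP_cbdd_add {d : ℕ} {p q : MvPolynomial σ (MvPolynomial τ R)}
    (hp : ∀ μ, (p.coeff μ).totalDegree ≤ d) (hq : ∀ μ, (q.coeff μ).totalDegree ≤ d) :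
    ∀ μ, ((p + q).coeff μ).totalDegree ≤ d :=
  fun μ => by
    rw [coeff_add]
    exact (totalDegree_add _ _).trans (max_le (hp μ) (hq μ))

/-- Coefficientwise degree bounds are preserved by finite sums. -/
private theorem certWindowQP_cbdd_sum {ι : Type*} {d : ℕ} (s : Finset ι)
    {f : ι → MvPolynomial σ (MvPolynomial τ R)}
    (h : ∀ i ∈ s, ∀ μ, ((f i).coeff μ).totalDegree ≤ d) :
    ∀ μ, ((∑ i ∈ s, f i).coeff μ).totalDegree ≤ d :=
  Finset.sum_induction f (fun p => ∀ μ, (p.coeff μ).totalDegree ≤ d)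
    (fun _ _ hp hq => certWindowQP_cbdd_add hp hq) (certWindowQP_cbdd_zero d) h

/-- Coefficientwise degree bounds add under multiplication (`MvPolynomial.coeff_mul`). -/
private theorem certWindowQP_cbdd_mul {d e : ℕ} {p q : MvPolynomial σ (MvPolynomial τ R)}
    (hp : ∀ μ, (p.coeff μ).totalDegree ≤ d) (hq : ∀ μ, (q.coeff μ).totalDegree ≤ e) :
    ∀ μ, ((p * q).coeff μ).totalDegree ≤ d + e :=
  fun μ => by
    classical
    rw [coeff_mul]
    exact totalDegree_finsetSum_le fun x _ =>
      (totalDegree_mul _ _).trans (add_le_add (hp x.1) (hq x.2))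

/-- The coefficients of a constant `C c` have total degree at most that of `c`. -/
private theorem certWindowQP_cbdd_C {d : ℕ} {c : MvPolynomial τ R} (hc : c.totalDegree ≤ d) :
    ∀ μ, ((C c : MvPolynomial σ (MvPolynomial τ R)).coeff μ).totalDegree ≤ d :=
  fun μ => by
    classical
    rw [coeff_C]
    split_ifs
    · exact hc
    · simp

/-- The coefficients of a variable `X e` (namely `0` and `1`) have total degree `0`. -/
private theorem certWindowQP_cbdd_X (e : σ) :
    ∀ μ, ((X e : MvPolynomial σ (MvPolynomial τ R)).coeff μ).totalDegree ≤ 0 :=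
  fun μ => by
    classical
    rw [coeff_X]
    split_ifs <;> simp

/-- The coefficients of an integer constant have total degree `0`. -/
private theorem certWindowQP_cbdd_intCast (k : ℤ) :
    ∀ μ, ((k : MvPolynomial σ (MvPolynomial τ R)).coeff μ).totalDegree ≤ 0 := by
  have h : (k : MvPolynomial σ (MvPolynomial τ R)) = C (C (k : R)) := by simp
  rw [h]
  exact certWindowQP_cbdd_C (totalDegree_C _).le

/-- A product over `s` of polynomials with coefficients of degree `≤ 1` has coefficients of
degree `≤ #s`. -/
private theorem certWindowQP_cbdd_prod {ι : Type*} (s : Finset ι)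
    {f : ι → MvPolynomial σ (MvPolynomial τ R)}
    (h : ∀ i ∈ s, ∀ μ, ((f i).coeff μ).totalDegree ≤ 1) :
    ∀ μ, ((∏ i ∈ s, f i).coeff μ).totalDegree ≤ s.card := by
  classical
  induction s using Finset.induction_on with
  | empty =>
    simpa using (certWindowQP_cbdd_C (σ := σ) (le_of_eq (totalDegree_one (σ := τ) (R := R))))
  | insert a s ha ih =>
    rw [Finset.prod_insert ha, Finset.card_insert_of_notMem ha, add_comm]
    exact certWindowQP_cbdd_mul (h a (Finset.mem_insert_self a s))
      (ih fun i hi => h i (Finset.mem_insert_of_mem hi))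

/-- **Leibniz bound.** If every entry of a square matrix of polynomials has coefficients of
degree `≤ 1`, the coefficients of its determinant have degree `≤` the size of the matrix. -/
private theorem certWindowQP_cbdd_det {k : Type*} [Fintype k] [DecidableEq k]
    {M : Matrix k k (MvPolynomial σ (MvPolynomial τ R))}
    (hM : ∀ i j, ∀ μ, ((M i j).coeff μ).totalDegree ≤ 1) :
    ∀ μ, (M.det.coeff μ).totalDegree ≤ Fintype.card k := by
  rw [Matrix.det_apply']
  refine certWindowQP_cbdd_sum _ fun π _ => ?_
  simpa [Finset.card_univ] using certWindowQP_cbdd_mul (certWindowQP_cbdd_intCast _)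
    (certWindowQP_cbdd_prod Finset.univ fun i _ => hM (π i) i)

end CoeffDegree

/-- Every axiom of `Rep(n,m)` — an `x`-coefficient of `det (A₀ + ∑ₑ xₑ Aₑ) - per_n` — has total
degree `≤ m` in the `(n²+1)m²` unknown entries (the determinant is a sum of signed products of
`m` entries, each of degree `≤ 1` in the unknowns; the permanent contributes constants). -/
theorem certWindowQP_coeffDegree (n m : ℕ) (μ : (Fin n × Fin n) →₀ ℕ) :
    (((Matrix.of fun i j : Fin m => MvPolynomial.C (MvPolynomial.X (none, (i, j))) + ∑ e : Fin n × Fin n, MvPolynomial.X e * MvPolynomial.C (MvPolynomial.X (some e, (i, j))) : Matrix (Fin m) (Fin m) (MvPolynomial (Fin n × Fin n) (MvPolynomial (Option (Fin n × Fin n) × (Fin m × Fin m)) ℂ))).det - MvPolynomial.map MvPolynomial.C (Literature.Computability.AlgebraicComplexity.perPoly (Fin n) ℂ)).coeff μ).totalDegree ≤ m := by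
  rw [coeff_sub, coeff_map]
  refine (totalDegree_sub _ _).trans (max_le ?_ (by simp))
  have hdet := certWindowQP_cbdd_det (σ := Fin n × Fin n)
    (τ := Option (Fin n × Fin n) × (Fin m × Fin m)) (R := ℂ)
    (M := Matrix.of fun i j : Fin m => MvPolynomial.C (MvPolynomial.X (none, (i, j))) +
      ∑ e : Fin n × Fin n, MvPolynomial.X e * MvPolynomial.C (MvPolynomial.X (some e, (i, j))))
    (fun i j => ?_) μ
  · simpa using hdet
  · rw [Matrix.of_apply]
    refine certWindowQP_cbdd_add (certWindowQP_cbdd_C (totalDegree_X _).le)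
      (certWindowQP_cbdd_sum _ fun e _ => ?_)
    simpa using certWindowQP_cbdd_mul (certWindowQP_cbdd_X e)
      (certWindowQP_cbdd_C (σ := Fin n × Fin n) (totalDegree_X (R := ℂ) (some e, (i, j))).le)

/-- **Registered stub `stub_coeffDegree`** of line `Sketch` (crux `CertWindowQP`, stmt-ValiantsHypothesis-5640),
verbatim signature of the registered skeleton `Cruxes/CertWindowQP/Lines/Sketch.lean`; proved by the
theorem above. -/
theorem stub_coeffDegree (n m : ℕ) (μ : (Fin n × Fin n) →₀ ℕ) :
    (((Matrix.of fun i j : Fin m => MvPolynomial.C (MvPolynomial.X (none, (i, j))) + ∑ e : Fin n × Fin n, MvPolynomial.X e * MvPolynomial.C (MvPolynomial.X (some e, (i, j))) : Matrix (Fin m) (Fin m) (MvPolynomial (Fin n × Fin n) (MvPolynomial (Option (Fin n × Fin n) × (Fin m × Fin m)) ℂ))).det - MvPolynomial.map MvPolynomial.C (Literature.Computability.AlgebraicComplexity.perPoly (Fin n) ℂ)).coeff μ).totalDegree ≤ m :=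
  certWindowQP_coeffDegree n m μ

end Summit.ValiantsHypothesis.ValiantsHypothesis.Theorems
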